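import Summits.Ventures.YMGap.BEDoor.AnalyticStrip

/-!
# BEDoor / SU2 — §9d–e `SU(2)`, `d = 4`: the door as ONE inequality in `(β, η)` and the numeric instance `16.2|β| + 4.4η < 1` at `κ = 1`, `r = 1`
# (module 11/11 of the Bakry–Émery door, LIFT edition v8.3 = parts `SU2` (v8.2 module 16); cell `ym-beyond`, seat P4)

HONEST FRAMING (cell `ym-beyond`, seat P4 «Hessian-currency receiver», lens Y2; HUMAN RULINGS D-0035 / D-0037; memo `HOME/ROUTE-P4Y2.md` v8.1 +
g10 addendum, spec `HOME/ROUTE-P4Y2-LIFT-SPEC-v83.md`; LIFT edition v8.3 = the v8.2 module bodies of `HOME/ROUTE-P4Y2-Sketch.lean` v8.1, byte-identical and in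
order, re-packed into 11 ≤ 400-line modules (fewer olean round-trips; director-ym line №2 (B)); the g10 appendix `OpenStrip` is a separate, UNQUEUED HOME file (line №3 (D))).  FINITE-LATTICE
statements at STRONG effective coupling: a RECEIVER («door») in HESSIAN (Bakry–Émery) currency for renormalisation-group output, typed over the
tree's generic clustering chain `Thresholds/SharpClustering*` + `Thresholds/LatticeBakryEmery*`, complementary to the Dobrushin-currency door
`YM4Door/*` (LITERALLY the same INPUT predicate `QuasiLocalGaugePerturbation.HasAnalyticNormLE … stripDomain`, the same OUTPUT predicate
`RobustBall.ClustersWith`; no residual hypothesis: Osgood regularity is the tree's `Literature.Analysis.Complex.SCV.contDiffOn_infty`,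
part `Osgood` of module `AnalyticStrip`).  Nothing here is a statement about `β → ∞`, the continuum limit or the Clay problem; NO effective action is asserted to be at
the door (that INPUT is not in print for `d = 4`); the verdict «the two windows do not meet» is unchanged in this currency.
WHAT THIS IS NOT (ladder rung R2d; director-ym line №2 (B)): every door of this LIFT is an entry on the STRONG-COUPLING BANK of THE NUMBER —
finite-lattice exponential clustering at SMALL `|β|` and small strip norm `η` of the perturbation (`SU(2)`, `d = 4`: `16.2|β| + 4.4η < 1`, module `SU2`,
conclusion literally `RobustBall.ClustersWith`) — NOT clustering at weak coupling, NOT a statement at large `β`, NOT the mass gap.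
No conjecture name, no `sorry`, no axiom beyond the standard three; every theorem is bookkeeping over the tree. [folklore]
References: H. Shen, R. Zhu, X. Zhu, CMP 400 (2023) 805 (arXiv:2204.12737) Thm 1.2, Cor. 4.4/4.11; D. Bakry, M. Émery, LNM 1123 (1985);
T. Bałaban, CMP 109 (1987) 249, (1.18)–(1.22) (analyticity format); L. Hörmander, An Introduction to Complex Analysis in Several Variables
(1973) Thm 2.2.1/2.2.6 (Osgood); E. J. McShane, Bull. AMS 40 (1934) 837 (Lipschitz extension).

THIS MODULE, part `SU2` (§9d–e `SU(2)`, `d = 4`: the door as ONE inequality in `(β, η)` and the numeric instance at `κ = 1`, `r = 1`):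
`su2_clustersWith_of_strip_hessian` (`16|β|(1 + (9/8)(e^{κ'} − 1)) + (2/r''²)(1 + 32κ'/(e²(κ−κ')²))·η < 1 ⇒ ClustersWith W β (1 − LHS)⁻¹ κ'`),
`eta_nonneg_of_hasAnalyticNormLE_strip`, ★ `su2_clustersWith_numeric` (`κ' = 1/100`, `r'' = 69/100`: **`16.2|β| + 4.4η < 1 ⇒ ClustersWith W β (1 −
16.2|β| − 4.4η)⁻¹ (1/100)`**, LITERALLY on `W.HasAnalyticNormLE (fundamentalRep (Fin 2)) (fun _ => stripDomain _ 1) 1 η`; P2's Dobrushin cells on the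
same input: η ≤ .112/.049/.037/.0037 for β ∈ {0}/[0,1/16]/[0,1/12]/[0,1/6] — NOT NESTED).
-/

noncomputable section

open scoped Matrix ComplexConjugate BigOperators Matrix.Norms.Frobenius ContDiff Topology
open Matrix Complex Finset MeasureTheory Filter
open Literature.MathematicalPhysics.QuantumFieldTheory
open Literature.MathematicalPhysics.QuantumFieldTheory.SUNBakryEmery (SUN FrameIdx frame)

namespace Summit.Ventures.YMGap.BEDoor

open Summit.Ventures.YMGap Summit.Ventures.YMGap.LatticeBakryEmery Summit.Ventures.YMGap.SharpClustering
open Summit.Ventures.YMGap.HessianSharp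

universe u

section AnalyticInputSU2

variable {d N : ℕ} {L : ℕ} [NeZero L]

open scoped ProbabilityTheory
open ProbabilityTheory
open Literature.MathematicalPhysics.QuantumLattice (fundamentalRep fundamentalRep_apply)

/-! ### §9d. `SU(2)`, `d = 4`: the door as one inequality in `(β, η)` at the tree coupling -/

/-- ★★★ **`SU(2)`, `d = 4`, TREE COUPLING `β` (the measure `W.perturbedMeasure (fundamentalRep) β`, as in P2's `ClustersWith W β …`)**:
with `Λ₀ = 16` (`wilsonHessianBound_four_d`), INPUT P2's `W.HasAnalyticNormLE … (strip r) κ η` + thin supports, any rate `0 ≤ κ' < κ` and width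
`0 < r'' < log (1 + r)`: the door is the single inequality
`16|β|(1 + (9/8)(e^{κ'} − 1)) + (2/r''²)(1 + 32κ'/(e²(κ−κ')²))·η < 1`,
and then `ClustersWith W β (1 − LHS)⁻¹ κ'`. [folklore assembly] [folklore] -/
theorem su2_clustersWith_of_strip_hessian (hL : 1 < L) (W : RobustBall.Perturbation 4 L 2) {r κ κ' η : ℝ} (β : ℝ)
    (hr : 0 < r) (hW : W.HasAnalyticNormLE (fundamentalRep (Fin 2)) (fun _ => stripDomain (d := 4) (L := L) (fundamentalRep (Fin 2)) r) κ η)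
    (hsupp : ∀ X, W.act X ≠ 0 → (RobustBall.polymerDiam X : ℝ) ≤ (X.card : ℝ) - 1)
    (hκ' : 0 ≤ κ') (hκ : κ' < κ) {r'' : ℝ} (hr''0 : 0 < r'') (hr'' : r'' < Real.log (1 + r))
    (hdoor : 16 * |β| * (1 + 9 / 8 * (Real.exp κ' - 1)) +
      2 / r'' ^ 2 * (1 + 32 * κ' / (Real.exp 2 * (κ - κ') ^ 2)) * η < 1) :
    RobustBall.ClustersWith W β
      (1 / (1 - (16 * |β| * (1 + 9 / 8 * (Real.exp κ' - 1)) +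
        2 / r'' ^ 2 * (1 + 32 * κ' / (Real.exp 2 * (κ - κ') ^ 2)) * η))) κ' := by
  have hH := wilsonHessianBound_four_d (d := 4) (N := 2)
  have hKeq : ((2 : ℕ) : ℝ) / 2 - (((2 : ℕ) : ℝ) * |β / 2| * (4 * ((4 : ℕ) : ℝ)) + 2 * η / r'' ^ 2) -
      (max (6 * (((4 : ℕ) : ℝ) - 1) * ((2 : ℕ) : ℝ) * |β / 2|) 0 * (Real.exp κ' - 1) +
        16 * ((4 : ℕ) : ℝ) * κ' * η / (Real.exp 2 * r'' ^ 2 * (κ - κ') ^ 2)) =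
      1 - (16 * |β| * (1 + 9 / 8 * (Real.exp κ' - 1)) +
        2 / r'' ^ 2 * (1 + 32 * κ' / (Real.exp 2 * (κ - κ') ^ 2)) * η) := by
    have hb : |β / 2| = |β| / 2 := by rw [abs_div, abs_two]
    rw [hb, max_eq_left (by positivity)]
    push_cast
    field_simp
    ring
  have hK : 0 < ((2 : ℕ) : ℝ) / 2 - (((2 : ℕ) : ℝ) * |β / 2| * (4 * ((4 : ℕ) : ℝ)) + 2 * η / r'' ^ 2) -
      (max (6 * (((4 : ℕ) : ℝ) - 1) * ((2 : ℕ) : ℝ) * |β / 2|) 0 * (Real.exp κ' - 1) +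
        16 * ((4 : ℕ) : ℝ) * κ' * η / (Real.exp 2 * r'' ^ 2 * (κ - κ') ^ 2)) := by
    rw [hKeq]; linarith
  have h := clustersWith_of_strip_hessian hH (by norm_num) (β / 2) hL W hr hW hsupp hκ' hκ hr''0 hr'' hK
  rw [hKeq, show ((2 : ℕ) : ℝ) * (β / 2) = β by push_cast; ring] at h
  exact h

/-! ### §9e. A numeric instance at P2's strip parameters `κ = 1`, `r = 1` -/

/-- `η ≥ 0` under the strip bound (the strip contains the configuration `1`, and `blockCorners 1 ∋ 0`). [folklore] -/
theorem eta_nonneg_of_hasAnalyticNormLE_strip {r κ η : ℝ} (hr : 0 < r) {W : RobustBall.Perturbation d L N}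
    (hW : W.HasAnalyticNormLE (fundamentalRep (Fin N))
      (fun _ => stripDomain (d := d) (L := L) (fundamentalRep (Fin N)) r) κ η) : 0 ≤ η := by
  obtain ⟨M, hA, hsum⟩ := hW
  have hM0 : ∀ X ∈ polymers (d := d) (L := L) 1, 0 ≤ M X := fun X hX => by
    obtain ⟨F, -, -, hb⟩ := hA X hX
    exact (norm_nonneg _).trans (hb _ (complexify_mem_stripDomain _ hr 1))
  have h0 : (0 : Site d L) ∈ blockCorners (d := d) (L := L) 1 := by
    simp only [blockCorners, Finset.mem_image, Finset.mem_univ, true_and]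
    exact ⟨0, blockCorner_one 0⟩
  refine le_trans (Finset.sum_nonneg fun X hX => ?_) (hsum 0 h0)
  exact mul_nonneg (hM0 X (mem_polymersThrough_iff.1 hX).1) (Real.exp_pos _).le

/-- ★★★ **`SU(2)`, `d = 4`, NUMERIC DOOR at P2's strip parameters** (`κ = 1`, `r = 1`; choices `κ' = 1/100` = P2's output rate,
`r'' = 69/100 < log 2`): if `(81/5)|β| + (22/5)η < 1` (i.e. `16.2|β| + 4.4η < 1`) then
`ClustersWith W β (1 − 16.2|β| − 4.4η)⁻¹ (1/100)` — LITERALLY on P2's input predicate, no residual hypothesis.  Compare P2's Dobrushin door on the same input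
(`su2_clustersWith_of_strip_haar`: `β = 0`-slice … cells `β ≤ 1/6`, `2η ≤ 11/500`): the two doors are not nested. [folklore arithmetic] [folklore] -/
theorem su2_clustersWith_numeric (hL : 1 < L) (W : RobustBall.Perturbation 4 L 2) {η : ℝ} (β : ℝ)
    (hW : W.HasAnalyticNormLE (fundamentalRep (Fin 2)) (fun _ => stripDomain (d := 4) (L := L) (fundamentalRep (Fin 2)) 1) 1 η)
    (hsupp : ∀ X, W.act X ≠ 0 → (RobustBall.polymerDiam X : ℝ) ≤ (X.card : ℝ) - 1)
    (hdoor : 81 / 5 * |β| + 22 / 5 * η < 1) :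
    RobustBall.ClustersWith W β (1 / (1 - (81 / 5 * |β| + 22 / 5 * η))) (1 / 100) := by
  have hη := eta_nonneg_of_hasAnalyticNormLE_strip one_pos hW
  -- `e^{1/100} ≤ 100/99`
  have he1 : Real.exp (1 / 100) ≤ 100 / 99 := by
    have h := Real.add_one_le_exp (-(1 / 100 : ℝ))
    have hx : Real.exp (-(1 / 100 : ℝ)) * Real.exp (1 / 100) = 1 := by
      rw [← Real.exp_add, neg_add_cancel, Real.exp_zero]
    nlinarith [Real.exp_pos (1 / 100 : ℝ), Real.exp_pos (-(1 / 100 : ℝ))]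
  -- `e² ≥ 7.389`
  have he2 : (7389 / 1000 : ℝ) ≤ Real.exp 2 := by
    have h1 := Real.exp_one_gt_d9
    have h2 : Real.exp 2 = Real.exp 1 * Real.exp 1 := by rw [← Real.exp_add]; norm_num
    nlinarith [Real.exp_pos (1 : ℝ)]
  -- the two coefficients
  have hcβ : 16 * (1 + 9 / 8 * (Real.exp (1 / 100) - 1)) ≤ 81 / 5 := by linarith
  have hcη : 2 / (69 / 100 : ℝ) ^ 2 * (1 + 32 * (1 / 100) / (Real.exp 2 * (1 - 1 / 100) ^ 2)) ≤ 22 / 5 := by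
    have hA : 32 * (1 / 100 : ℝ) / (Real.exp 2 * (1 - 1 / 100) ^ 2) ≤
        32 * (1 / 100) / (7389 / 1000 * (1 - 1 / 100) ^ 2) :=
      div_le_div_of_nonneg_left (by norm_num) (by positivity) (by nlinarith [he2])
    have hB : 2 / (69 / 100 : ℝ) ^ 2 * (1 + 32 * (1 / 100) / (7389 / 1000 * (1 - 1 / 100) ^ 2)) ≤ 22 / 5 := by
      norm_num
    have hA' : (1 : ℝ) + 32 * (1 / 100) / (Real.exp 2 * (1 - 1 / 100) ^ 2) ≤
        1 + 32 * (1 / 100) / (7389 / 1000 * (1 - 1 / 100) ^ 2) := by linarith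
    exact le_trans (mul_le_mul_of_nonneg_left hA' (by norm_num)) hB
  have hle : 16 * |β| * (1 + 9 / 8 * (Real.exp (1 / 100) - 1)) +
      2 / (69 / 100 : ℝ) ^ 2 * (1 + 32 * (1 / 100) / (Real.exp 2 * (1 - 1 / 100) ^ 2)) * η ≤
      81 / 5 * |β| + 22 / 5 * η := by
    have h1 : 16 * |β| * (1 + 9 / 8 * (Real.exp (1 / 100) - 1)) ≤ 81 / 5 * |β| := by
      have := mul_le_mul_of_nonneg_left hcβ (abs_nonneg β); linarith
    have h2 := mul_le_mul_of_nonneg_right hcη hη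
    linarith
  have hr'' : (69 / 100 : ℝ) < Real.log (1 + 1) := by
    rw [one_add_one_eq_two]; linarith [Real.log_two_gt_d9]
  have h := su2_clustersWith_of_strip_hessian hL W β one_pos hW hsupp (κ' := 1 / 100) (by norm_num) (by norm_num)
    (r'' := 69 / 100) (by norm_num) hr'' (by linarith)
  refine h.mono_const (one_div_le_one_div_of_le (by linarith) (by linarith))

end AnalyticInputSU2

end Summit.Ventures.YMGap.BEDoor
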